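import Literature.Topology.FourManifolds.RouteMonotoneP
import HarnessLib

/-!
# The route down the push-off, with an independent height window for the angle

Topic `Literature/Topology/FourManifolds`; fact seat `provefact-IsStrictHandleSlide.isSurgery`
(R. C. Kirby, *The Topology of 4-Manifolds*, LNM 1374 (1989), Ch. I §4, Fig. 4.2; remaining content:
the named fact (S) `Literature.Topology.FourManifolds.FramedLink.IsStrictHandleSlide.slideModel`).
Variant of `RouteMonotoneP.lean` in which the smoothness and the negativity of the derivative of the
slice angle `Θ` down the push-off are assumed on an arbitrary open height interval `(j₁, j₂)`
containing the heights `H₁ [t_L, τ₁]`, instead of the window `(w₁, w₂)` of the `RouteHyp` — which,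
when the data are instantiated, is the *small* height range of the final approach (where the route
angle must stay in `(0, π)`), while the descent down the push-off reaches much lower heights. The
proofs are those of `RouteMonotoneP.lean` verbatim (primed names).

## References

* R. C. Kirby, *The Topology of 4-Manifolds*, LNM 1374, Springer (1989), Ch. I §4. [Kirby1989]
-/

open scoped Topology ContDiff
open Set Real Filter

noncomputable section

namespace Literature.Topology.FourManifolds

namespace RouteHyp

variable {d : K2LiteData} (R : RouteHyp d)

/-- **Down the push-off `ẏ < 0`** as long as the heights stay in the window and the angle is
below `π`. [folklore] -/
theorem deriv_y_neg_P' {τ₁ : ℝ} (hτ₁ : τ₁ ≤ d.b + d.ε) {j₁ j₂ : ℝ} (hΘJ : ContDiffOn ℝ ∞ R.Θ (Ioo j₁ j₂))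
    (hwinP : ∀ τ ∈ Icc d.tL τ₁, d.H₁ τ ∈ Ioo j₁ j₂)
    (hΘπ : ∀ τ ∈ Icc d.tL τ₁, R.Θ (d.H₁ τ) < π) (hΘneg : ∀ h ∈ Ioo j₁ j₂, deriv R.Θ h < 0)
    {τ : ℝ} (hτ : τ ∈ Ioc d.tL τ₁) :
    HasDerivAt R.y (cos (R.α τ) * (twistQ R.c 1 (R.θ τ) * (deriv R.Θ (d.H₁ τ) * deriv d.H₁ τ))) τ ∧
      cos (R.α τ) * (twistQ R.c 1 (R.θ τ) * (deriv R.Θ (d.H₁ τ) * deriv d.H₁ τ)) < 0 := by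
  have hτ' : τ ∈ Icc d.tL τ₁ := ⟨hτ.1.le, hτ.2⟩
  have hwin := hwinP τ hτ'
  -- derivative data
  have hH : HasDerivAt d.H₁ (deriv d.H₁ τ) τ := (d.contDiff_H₁.differentiable (by simp) τ).hasDerivAt
  have hΘd : HasDerivAt R.Θ (deriv R.Θ (d.H₁ τ)) (d.H₁ τ) :=
    ((hΘJ.differentiableOn (by simp)).differentiableAt (Ioo_mem_nhds hwin.1 hwin.2)).hasDerivAt
  have hθ : HasDerivAt R.θ (deriv R.Θ (d.H₁ τ) * deriv d.H₁ τ) τ := hΘd.comp τ hH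
  have hr := R.hasDerivAt_r_P hτ.1
  -- the angle lies in `(0, π)`: it is above the landing angle, which is positive
  have hθL : 0 < R.θ d.tL := R.θ_pos ⟨d.tD_lt_tL.le, le_rfl⟩
  have hΘanti : AntitoneOn R.Θ (Ioo j₁ j₂) :=
    (antitoneOn_of_deriv_nonpos (convex_Ioo _ _) (hΘJ.continuousOn)
      ((hΘJ.differentiableOn (by simp)).mono interior_subset) fun h hh ↦ by
        rw [interior_Ioo] at hh; exact (hΘneg h hh).le)
  have hHanti := d.strictAntiOn_H₁
  have htL_le : d.tL ≤ d.b + d.ε := by linarith [d.tL_mem.2, d.ε_pos]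
  have hHle : d.H₁ τ ≤ d.H₁ d.tL :=
    (hHanti.antitoneOn ⟨le_rfl, htL_le⟩ ⟨hτ.1.le, hτ.2.trans hτ₁⟩ hτ.1.le)
  have hθge : R.θ d.tL ≤ R.θ τ := by
    rw [θ, θ]
    exact hΘanti hwin (hwinP d.tL ⟨le_rfl, hτ.1.le.trans hτ.2⟩) hHle
  have hθmem : R.θ τ ∈ Ioo (-π) π := ⟨by linarith [pi_pos], hΘπ τ hτ'⟩
  have hθLmem : R.θ d.tL ∈ Ioo (-π) π := R.θ_mem_Ioo ⟨d.tD_lt_tL.le, le_rfl⟩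
  -- `y' = cos α · q · θ'` with `r = 1`, `r' = 0`
  have hy := hasDerivAt_curveY R.c hr hθ hθmem
  have hr1 : R.r τ = 1 := R.r_of_tL_le hτ.1.le
  simp only [zero_mul, mul_zero, zero_add] at hy
  rw [hr1, one_mul] at hy
  have hαeq : R.α τ = twistAngle R.c 1 (R.θ τ) := by rw [α, hr1]
  refine ⟨?_, ?_⟩
  · rw [hαeq]; exact hy
  -- signs: `cos α < 0`, `q > 0`, `Θ' < 0`, `H₁' < 0`
  have hαL := R.α_tL_mem
  have hαge : R.α d.tL ≤ R.α τ := by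
    rw [hαeq, α, R.r_tL]
    exact (strictMonoOn_twistAngle R.c 1).monotoneOn hθLmem hθmem hθge
  have hαlt : R.α τ < π := by rw [hαeq]; exact (twistAngle_mem_Ioo R.c 1 (R.θ τ)).2
  have hcos : cos (R.α τ) < 0 := cos_neg_of_pi_div_two_lt_of_lt (by linarith [hαL.1]) (by linarith [pi_pos])
  have hq : 0 < twistQ R.c 1 (R.θ τ) := twistQ_pos R.c 1 hθmem
  have hΘ' : deriv R.Θ (d.H₁ τ) < 0 := hΘneg _ hwin
  have hH' : deriv d.H₁ τ < 0 := d.deriv_H₁_neg ⟨hτ.1.le, hτ.2.trans hτ₁⟩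
  have hprod : 0 < deriv R.Θ (d.H₁ τ) * deriv d.H₁ τ := mul_pos_of_neg_of_neg hΘ' hH'
  exact mul_neg_of_neg_of_pos hcos (mul_pos hq hprod)

/-- **The twisted height is strictly decreasing along the whole route from the tip down the
push-off**, on `[t_D, τ₁]`. [cite: Kirby1989, Ch. I §4] -/
theorem strictAntiOn_y_ext' {τ₁ : ℝ} (hτ₁ : τ₁ ≤ d.b + d.ε) {j₁ j₂ : ℝ} (hΘJ : ContDiffOn ℝ ∞ R.Θ (Ioo j₁ j₂))
    (hwinP : ∀ τ ∈ Icc d.tL τ₁, d.H₁ τ ∈ Ioo j₁ j₂)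
    (hΘπ : ∀ τ ∈ Icc d.tL τ₁, R.Θ (d.H₁ τ) < π) (hΘneg : ∀ h ∈ Ioo j₁ j₂, deriv R.Θ h < 0) :
    StrictAntiOn R.y (Icc d.tD τ₁) := by
  -- derivative everywhere on `[t_D, τ₁]`, negative
  have hd : ∀ τ ∈ Icc d.tD τ₁, HasDerivAt R.y (deriv R.y τ) τ ∧ deriv R.y τ < 0 := by
    intro τ hτ
    rcases le_or_gt τ d.tL with h | h
    · have h' : τ ∈ Icc d.tD d.tL := ⟨hτ.1, h⟩
      exact ⟨by have := R.hasDerivAt_y h'; rwa [← this.deriv] at this, R.deriv_y_neg h'⟩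
    · obtain ⟨hy, hneg⟩ := R.deriv_y_neg_P' hτ₁ hΘJ hwinP hΘπ hΘneg ⟨h, hτ.2⟩
      rw [← hy.deriv] at hneg
      exact ⟨by rwa [← hy.deriv] at hy, hneg⟩
  refine strictAntiOn_of_deriv_neg (convex_Icc _ _) (fun τ hτ ↦ (hd τ hτ).1.continuousAt.continuousWithinAt) ?_
  intro τ hτ
  rw [interior_Icc] at hτ
  exact (hd τ (Ioo_subset_Icc_self hτ)).2

end RouteHyp

end Literature.Topology.FourManifolds
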